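import Summits.QuantumFields.BalabanUV.Beta.RemainderExplicitHistoryDiagonalRate
import Summits.QuantumFields.BalabanUV.Beta.RemainderExplicitHistoryDiagonalRateLower
import Summits.QuantumFields.BalabanUV.Beta.RemainderExplicitHistoryDiagonalExamples

/-!
# RemainderExplicitHistoryDiagonalRateBorderline — ROAD P3, ORDER-0 PROFILE FAMILY: THE RATE IN THE CUTOFF FOR THE BORDERLINE PROFILE
# `ρ(a) = M∕((a+1)√(a+1))` — its tails admit the majorant `τ(k) = 3M∕√(k+1)` (shape constants `A₁ = 3`, `A₂ = 18√2·M`) and the minorant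
# `τ′(k) = M∕(3√(k+1))`, so for every pinned family of runs (`Wγ < b`) and `18√2·M ≤ b√b·√m`, `m ≤ n + 1`:
# `astar g m − invSq g m n ≤ Λ·√m·3M∕√(n+2)` (`Λ = 4∕√b + 24√2κ∕((1−Wγ∕b)√b)`), and (no smallness, `1 ≤ m ≤ n+1`) SOME `m′ ≤ m` has
# `√m·M∕(3√(n+m+1)) ≤ 8κ₂√b₂(1+Wγ∕b)·(astar g m′ − invSq g m′ (n+m−m′))` — at the road's borderline profile (m-UNIFORM with INFINITE half
# moment, generation 48) the continuum coupling is reached at the RATE `√m∕√n` (fifth file of station S-d4p3-g49-1 «the rate in the cutoff»)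

Cell `pub-balaban`, β-function sub-cell, BINDER row D4 «RemainderConst leaves for Bałaban's split» (`HOME/BINDER-OWNERS.md`; owner
lineage `b2b-balaban-beta-an4`; this file by co-owner #3 lineage `b2b-balaban-beta-d4-p3`, road P3 «the reduction road», generation 49,
station S-d4p3-g49-1, fifth file; imports the station's third and fourth files and generation 48's `RemainderExplicitHistoryDiagonalExamples`
(the borderline profile's `borderline_minSq_le`, `borderline_sum_le`)), β-FLOW TEAM duty (1); FREEZE (0) honoured (def-free module in road
P3's own `RemainderExplicit*` series; no leaf, no interface, no Literature file).  SOURCE OF THE SHAPES ONLY: [Balaban1987RG1] (0.20) p. 256,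
(0.31) and Thm 2 p. 259, §5 p. 298.  Pure real analysis about ONE explicit toy family (ours).

HONEST FRAMING (page 1 of everything the β sub-cell writes).  *"Discharging BetaPertH makes Bałaban's UV stability UNCONDITIONAL — a real
constructive-QFT result; it is NOT the continuum limit and NOT the Clay problem."*  THIS FILE DISCHARGES NOTHING OF THE KIND.  It checks
that the shape hypotheses (T1), (T2) of the third file are inhabited by the road's natural example — the BORDERLINE profile of generation 48
(`Σρ(a)min(a,m)² = O(m√m)` so the cutoff discrepancy is m-uniform, while the half moment diverges): (T1) is generation 48's
`borderline_minSq_le` (`5M·K√K ≤ 3·K²·3M∕√(K+1)`), (T2) is the convolution estimate `Σ_{i<j₀} 1∕(√(i+2)·(j₀+1−i)^{3∕2}) ≤ 6√2∕√(j₀+2)` (§1: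
the young half of the positions against the square-root head `Σ 1∕√(i+1) ≤ 2√·`, the old half against the `3∕2`-tail `Σ_{v≥2} v^{−3∕2} ≤ 2`),
the tail majorant `Σ_{a∈[k,N)} ρ(a) ≤ 3M∕√(k+1)` and minorant `≥ M∕(3√(k+1))` (`N ≥ 2k`, `k ≥ 1`) are generation 43's `sum_Ico_inv_mul_sqrt_le`
and a block count.  §2 reads off the two-sided rate for every pinned family of runs of the borderline family, and packages one such family
(generation 47's `runFamily_exists`).  Nothing of Bałaban's (1.22) is asserted or constructed; row D4 class UNCHANGED (critical-path width 0;
instance 0∕1; D4 DISCHARGE NO DATE); NOT B12 Thm 2, NOT BetaPertH, NOT continuum, NOT Clay.  HONEST DEPENDENCY: continuum YM on T⁴ ⇐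
BetaPertH ∧ nine spine estimates (0/9 proved); BetaPertH ⇐ (D1) ∧ (D4) ∧ CAP+tail; G-an2-4 gates asym, D1 and NE2/3/4.  ABSOLUTE RULE:
nothing is cited as a fact.

WHAT IS PROVED ([folklore]; 0 sorry; 0 `def`).
* §1 `borderline_tail_le` (`R(N) − R(k) ≤ 3M∕√(k+1)`), `borderline_tail_ge` (`k ≥ 1`, `N ≥ 2k` ⇒ `M∕(3√(k+1)) ≤ R(N) − R(k)`),
  `borderline_T1` (`Σ_{a<N} ρ(a)min(a,K)² ≤ 3·K²·(3M∕√(K+1))`), `sum_conv_sqrt_le` (`Σ_{i<j₀} 1∕(√(i+2)(j₀+1−i)√(j₀+1−i)) ≤ 6√2∕√(j₀+2)`),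
  `borderline_T2` (`Σ_{i<j₀} τ(i+1)τ(j₀−i)∕(j₀+1−i) ≤ 18√2M·τ(j₀+1)`).
* §2 **`borderline_rate`** (`astar g m − invSq g m n ≤ Λ√m·3M∕√(n+2)` for `18√2M ≤ b√b√m`, `m ≤ n+1`), **`borderline_rate_lower`**
  (`1 ≤ m ≤ n+1` ⇒ `∃ m′ ≤ m`, `√m·M∕(3√(n+m+1)) ≤ 8κ₂√b₂(1+Wγ∕b)·(astar g m′ − invSq g m′ (n+m−m′))`), `exists_family_borderline_rate`.
All letters NOT-IN-PRINT; `BetaFlowAsPrinted S` records a Markov β_n only ⇒ no junction of the as-printed interface changes.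
-/

noncomputable section

open Finset Filter Topology

namespace Summit.QuantumFields.BalabanUV.Beta.RemainderExplicitHistoryDiagonalRateBorderline

open Literature.MathematicalPhysics.QuantumFieldTheory.Balaban1983to89
open Literature.MathematicalPhysics.QuantumFieldTheory.Balaban1983to89.FlowStep
open Literature.MathematicalPhysics.QuantumFieldTheory.Balaban1983to89.T4CouplingMatching
open Literature.MathematicalPhysics.QuantumFieldTheory.Balaban1983to89.T4ContinuumCoupling
open Literature.MathematicalPhysics.QuantumFieldTheory.Balaban1983to89.T4OneLoopAsymptotics (sum_inv_sqrt_mul_succ_le)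
open Summit.QuantumFields.BalabanUV.Beta.RemainderExplicitHistoryHalfMoment (sum_Ico_inv_mul_sqrt_le)
open Summit.QuantumFields.BalabanUV.Beta.RemainderExplicitHistoryDiagonalExamples (borderline_minSq_le borderline_sum_le)
open Summit.QuantumFields.BalabanUV.Beta.RemainderExplicitHistoryDiagonalRate
open Summit.QuantumFields.BalabanUV.Beta.RemainderExplicitHistoryDiagonalRateLower

variable {β : HBeta} {b γ W M : ℝ} {ρ : ℕ → ℝ}

/-! ## §1 The borderline profile: tails both ways, and the two shape constants -/

/-- TAIL MAJORANT: for `ρ(a) = M∕((a+1)√(a+1))` (`M ≥ 0`) and `k ≤ N`, `Σ_{a<N} ρ(a) − Σ_{a<k} ρ(a) ≤ 3M∕√(k+1)` (`k = 0`: the whole sum is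
`≤ 3M`, generation 48's `borderline_sum_le`; `k ≥ 1`: the `3∕2`-tail `≤ 2M∕√k ≤ 3M∕√(k+1)`, generation 43's `sum_Ico_inv_mul_sqrt_le`). [folklore] -/
theorem borderline_tail_le (hM : 0 ≤ M) (hρ : ∀ a, ρ a = M / (((a : ℝ) + 1) * Real.sqrt ((a : ℝ) + 1))) {k N : ℕ} (hkN : k ≤ N) :
    ∑ a ∈ range N, ρ a - ∑ a ∈ range k, ρ a ≤ 3 * M / Real.sqrt ((k : ℝ) + 1) := by
  rw [← Finset.sum_Ico_eq_sub _ hkN]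
  have hsk1 : 0 < Real.sqrt ((k : ℝ) + 1) := Real.sqrt_pos.2 (by positivity)
  rcases Nat.eq_zero_or_pos k with hk | hk
  · subst hk
    simp only [Nat.cast_zero, zero_add, Real.sqrt_one, div_one]
    rw [show Ico 0 N = range N by rw [Finset.range_eq_Ico]]
    exact borderline_sum_le hM hρ N
  · have hsk : 0 < Real.sqrt (k : ℝ) := Real.sqrt_pos.2 (by exact_mod_cast hk)
    obtain ⟨N', rfl⟩ := Nat.exists_eq_add_of_le hkN
    calc ∑ a ∈ Ico k (k + N'), ρ a = M * ∑ a ∈ Ico k (k + N'), 1 / (((a : ℝ) + 1) * Real.sqrt ((a : ℝ) + 1)) := by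
          rw [Finset.mul_sum]; exact Finset.sum_congr rfl fun a _ => by rw [hρ a]; ring
      _ ≤ M * (2 / Real.sqrt (k : ℝ)) := mul_le_mul_of_nonneg_left (sum_Ico_inv_mul_sqrt_le hk N') hM
      _ ≤ M * (3 / Real.sqrt ((k : ℝ) + 1)) := by
          refine mul_le_mul_of_nonneg_left ?_ hM
          rw [div_le_div_iff₀ hsk hsk1]
          -- `2√(k+1) ≤ 3√k` since `4(k+1) ≤ 9k` for `k ≥ 1`
          have hk1 : (1 : ℝ) ≤ k := by exact_mod_cast hk
          have h1 : Real.sqrt ((k : ℝ) + 1) ≤ Real.sqrt (9 / 4 * k) := Real.sqrt_le_sqrt (by linarith)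
          have h2 : Real.sqrt (9 / 4 * (k : ℝ)) = 3 / 2 * Real.sqrt k := by
            rw [Real.sqrt_mul (by norm_num), show (9 / 4 : ℝ) = (3 / 2) ^ 2 by norm_num, Real.sqrt_sq (by norm_num)]
          rw [h2] at h1
          linarith
      _ = 3 * M / Real.sqrt ((k : ℝ) + 1) := by ring

/-- TAIL MINORANT: for the same profile (`M ≥ 0`), `k ≥ 1` and `N ≥ 2k`: `M∕(3√(k+1)) ≤ Σ_{a<N} ρ(a) − Σ_{a<k} ρ(a)` (the block `a ∈ [k, 2k)` has
`k` terms each `≥ M∕(2k·√(2k))`, and `2√2·√k ≤ 3√(k+1)`). [folklore] -/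
theorem borderline_tail_ge (hM : 0 ≤ M) (hρ : ∀ a, ρ a = M / (((a : ℝ) + 1) * Real.sqrt ((a : ℝ) + 1))) {k N : ℕ} (hk : 1 ≤ k)
    (hkN : 2 * k ≤ N) :
    M / (3 * Real.sqrt ((k : ℝ) + 1)) ≤ ∑ a ∈ range N, ρ a - ∑ a ∈ range k, ρ a := by
  have hρ0 : ∀ a, 0 ≤ ρ a := fun a => by rw [hρ a]; positivity
  rw [← Finset.sum_Ico_eq_sub _ (by omega : k ≤ N)]
  have hkr : (1 : ℝ) ≤ k := by exact_mod_cast hk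
  have hk0 : (0 : ℝ) < k := by linarith
  have hs2k : 0 < Real.sqrt (2 * (k : ℝ)) := Real.sqrt_pos.2 (by positivity)
  have hsk1 : 0 < Real.sqrt ((k : ℝ) + 1) := Real.sqrt_pos.2 (by positivity)
  -- the block `[k, 2k)`
  have hblock : ∑ a ∈ Ico k (2 * k), ρ a ≤ ∑ a ∈ Ico k N, ρ a :=
    Finset.sum_le_sum_of_subset_of_nonneg (Finset.Ico_subset_Ico_right hkN) fun a _ _ => hρ0 a
  have hterm : ∀ a ∈ Ico k (2 * k), M / ((2 * (k : ℝ)) * Real.sqrt (2 * (k : ℝ))) ≤ ρ a := by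
    intro a ha
    have ha' := (Finset.mem_Ico.mp ha).2
    have ha1 : (a : ℝ) + 1 ≤ 2 * k := by exact_mod_cast (by omega : a + 1 ≤ 2 * k)
    have ha0 : (0 : ℝ) < (a : ℝ) + 1 := by positivity
    rw [hρ a]
    refine div_le_div_of_nonneg_left hM (by positivity) ?_
    exact mul_le_mul ha1 (Real.sqrt_le_sqrt ha1) (Real.sqrt_nonneg _) (by positivity)
  have hsum := Finset.card_nsmul_le_sum (Ico k (2 * k)) ρ _ hterm
  rw [Nat.card_Ico, show 2 * k - k = k by omega, nsmul_eq_mul] at hsum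
  refine le_trans ?_ (hsum.trans hblock)
  -- `M∕(3√(k+1)) ≤ k·M∕(2k√(2k)) = M∕(2√(2k))`, i.e. `2√(2k) ≤ 3√(k+1)`
  have e : (k : ℝ) * (M / ((2 * (k : ℝ)) * Real.sqrt (2 * (k : ℝ)))) = M / (2 * Real.sqrt (2 * (k : ℝ))) := by
    field_simp
  rw [e]
  refine div_le_div_of_nonneg_left hM (by positivity) ?_
  have h1 : Real.sqrt (2 * (k : ℝ)) ≤ Real.sqrt (9 / 4 * ((k : ℝ) + 1)) := Real.sqrt_le_sqrt (by linarith)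
  have h2 : Real.sqrt (9 / 4 * ((k : ℝ) + 1)) = 3 / 2 * Real.sqrt ((k : ℝ) + 1) := by
    rw [Real.sqrt_mul (by norm_num), show (9 / 4 : ℝ) = (3 / 2) ^ 2 by norm_num, Real.sqrt_sq (by norm_num)]
  rw [h2] at h1
  linarith

/-- SHAPE (T1) WITH `A₁ = 3`: `Σ_{a<N} ρ(a)·min(a,K)² ≤ 3·K²·(3M∕√(K+1))` for `K ≥ 1` (generation 48's `borderline_minSq_le` gives `5M·K√K`, and
`5√K·√(K+1) ≤ 9K`). [folklore] -/
theorem borderline_T1 (hM : 0 ≤ M) (hρ : ∀ a, ρ a = M / (((a : ℝ) + 1) * Real.sqrt ((a : ℝ) + 1))) (K N : ℕ) (hK : 1 ≤ K) :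
    ∑ a ∈ range N, ρ a * (min (a : ℝ) K) ^ 2 ≤ 3 * (K : ℝ) ^ 2 * (3 * M / Real.sqrt ((K : ℝ) + 1)) := by
  have h := borderline_minSq_le hM hρ hK N
  refine h.trans ?_
  have hKr : (1 : ℝ) ≤ K := by exact_mod_cast hK
  have hK0 : (0 : ℝ) < K := by linarith
  have hsK : 0 < Real.sqrt (K : ℝ) := Real.sqrt_pos.2 hK0
  have hsK1 : 0 < Real.sqrt ((K : ℝ) + 1) := Real.sqrt_pos.2 (by linarith)
  -- `√K·√(K+1) ≤ (9∕5)·K`: square both sides, `25K(K+1) ≤ 81K²` for `K ≥ 1`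
  have hprod : Real.sqrt (K : ℝ) * Real.sqrt ((K : ℝ) + 1) ≤ 9 / 5 * K := by
    rw [← Real.sqrt_mul hK0.le]
    have h81 : (K : ℝ) * ((K : ℝ) + 1) ≤ (9 / 5 * K) ^ 2 := by nlinarith
    calc Real.sqrt ((K : ℝ) * ((K : ℝ) + 1)) ≤ Real.sqrt ((9 / 5 * K) ^ 2) := Real.sqrt_le_sqrt h81
      _ = 9 / 5 * K := Real.sqrt_sq (by positivity)
  rw [show 3 * (K : ℝ) ^ 2 * (3 * M / Real.sqrt ((K : ℝ) + 1)) = 9 * M * (K : ℝ) ^ 2 / Real.sqrt ((K : ℝ) + 1) by ring,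
    le_div_iff₀ hsK1]
  calc 5 * M * ((K : ℝ) * Real.sqrt K) * Real.sqrt ((K : ℝ) + 1) = 5 * M * K * (Real.sqrt K * Real.sqrt ((K : ℝ) + 1)) := by ring
    _ ≤ 5 * M * K * (9 / 5 * K) := mul_le_mul_of_nonneg_left hprod (by positivity)
    _ = 9 * M * (K : ℝ) ^ 2 := by ring

/-- THE CONVOLUTION ESTIMATE: `Σ_{i<j₀} 1∕(√(i+2)·(j₀+1−i)·√(j₀+1−i)) ≤ 6√2∕√(j₀+2)` — the young positions `i ≤ j₀∕2` see `j₀+1−i ≥ (j₀+2)∕2`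
and contribute the square-root head `Σ_{i≤j₀∕2} 1∕√(i+1) ≤ 2√(j₀∕2+1)` times `2√2∕((j₀+2)√(j₀+2))`; the old ones see `√(i+2) ≥ √((j₀+2)∕2)` and
contribute the `3∕2`-tail `Σ_{v≥2} 1∕(v√v) ≤ 2` times `√2∕√(j₀+2)`. [folklore] -/
theorem sum_conv_sqrt_le (j₀ : ℕ) :
    ∑ i ∈ range j₀, 1 / (Real.sqrt ((i : ℝ) + 2) * (((j₀ + 1 - i : ℕ) : ℝ) * Real.sqrt ((j₀ + 1 - i : ℕ) : ℝ)))
      ≤ 6 * Real.sqrt 2 / Real.sqrt ((j₀ : ℝ) + 2) := by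
  set h : ℕ := j₀ / 2 with hh
  have hJ : (0 : ℝ) < (j₀ : ℝ) + 2 := by positivity
  have hsJ : 0 < Real.sqrt ((j₀ : ℝ) + 2) := Real.sqrt_pos.2 hJ
  have hs2 : 0 < Real.sqrt 2 := Real.sqrt_pos.2 (by norm_num)
  have hsJ2 : Real.sqrt (((j₀ : ℝ) + 2) / 2) * Real.sqrt 2 = Real.sqrt ((j₀ : ℝ) + 2) := by
    rw [← Real.sqrt_mul (by positivity), div_mul_cancel₀ _ (two_ne_zero)]
  -- the two majorants
  set cA : ℝ := 2 * Real.sqrt 2 / (((j₀ : ℝ) + 2) * Real.sqrt ((j₀ : ℝ) + 2)) with hcA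
  set cB : ℝ := Real.sqrt 2 / Real.sqrt ((j₀ : ℝ) + 2) with hcB
  have hcA0 : 0 ≤ cA := by positivity
  have hcB0 : 0 ≤ cB := by positivity
  set fA : ℕ → ℝ := fun i => if i ≤ h then cA * (1 / Real.sqrt ((i : ℝ) + 1)) else 0 with hfA
  set fB : ℕ → ℝ := fun i => cB * (1 / ((((j₀ + 1 - i : ℕ) : ℝ)) * Real.sqrt ((j₀ + 1 - i : ℕ) : ℝ))) with hfB
  -- termwise: each summand is `≤ fA i + fB i`
  have hterm : ∀ i ∈ range j₀, 1 / (Real.sqrt ((i : ℝ) + 2) * (((j₀ + 1 - i : ℕ) : ℝ) * Real.sqrt ((j₀ + 1 - i : ℕ) : ℝ)))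
      ≤ fA i + fB i := by
    intro i hi
    have hi' := Finset.mem_range.mp hi
    have hv0 : (0 : ℝ) < ((j₀ + 1 - i : ℕ) : ℝ) := by exact_mod_cast (by omega : 0 < j₀ + 1 - i)
    have hsv : 0 < Real.sqrt ((j₀ + 1 - i : ℕ) : ℝ) := Real.sqrt_pos.2 hv0
    have hsi2 : 0 < Real.sqrt ((i : ℝ) + 2) := Real.sqrt_pos.2 (by positivity)
    have hsi1 : 0 < Real.sqrt ((i : ℝ) + 1) := Real.sqrt_pos.2 (by positivity)
    have hfA0 : 0 ≤ fA i := by simp only [hfA]; split_ifs <;> positivity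
    have hfB0 : 0 ≤ fB i := by simp only [hfB]; positivity
    by_cases hih : i ≤ h
    · -- young position: `v ≥ (j₀+2)∕2`
      have hv : ((j₀ : ℝ) + 2) / 2 ≤ ((j₀ + 1 - i : ℕ) : ℝ) := by
        have : (j₀ : ℝ) + 2 ≤ 2 * ((j₀ + 1 - i : ℕ) : ℝ) := by exact_mod_cast (by omega : j₀ + 2 ≤ 2 * (j₀ + 1 - i))
        linarith
      have hvv : ((j₀ : ℝ) + 2) / 2 * Real.sqrt (((j₀ : ℝ) + 2) / 2)
          ≤ ((j₀ + 1 - i : ℕ) : ℝ) * Real.sqrt ((j₀ + 1 - i : ℕ) : ℝ) :=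
        mul_le_mul hv (Real.sqrt_le_sqrt hv) (Real.sqrt_nonneg _) hv0.le
      have h1 : 1 / (((j₀ + 1 - i : ℕ) : ℝ) * Real.sqrt ((j₀ + 1 - i : ℕ) : ℝ))
          ≤ 1 / (((j₀ : ℝ) + 2) / 2 * Real.sqrt (((j₀ : ℝ) + 2) / 2)) := one_div_le_one_div_of_le (by positivity) hvv
      have hq : Real.sqrt (((j₀ : ℝ) + 2) / 2) = Real.sqrt ((j₀ : ℝ) + 2) / Real.sqrt 2 := by
        rw [eq_div_iff hs2.ne']; exact hsJ2
      have e1 : 1 / (((j₀ : ℝ) + 2) / 2 * Real.sqrt (((j₀ : ℝ) + 2) / 2)) = cA := by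
        rw [hcA, hq, div_mul_div_comm, one_div_div]
      have h2 : 1 / Real.sqrt ((i : ℝ) + 2) ≤ 1 / Real.sqrt ((i : ℝ) + 1) :=
        one_div_le_one_div_of_le hsi1 (Real.sqrt_le_sqrt (by linarith))
      calc 1 / (Real.sqrt ((i : ℝ) + 2) * (((j₀ + 1 - i : ℕ) : ℝ) * Real.sqrt ((j₀ + 1 - i : ℕ) : ℝ)))
          = (1 / Real.sqrt ((i : ℝ) + 2)) * (1 / (((j₀ + 1 - i : ℕ) : ℝ) * Real.sqrt ((j₀ + 1 - i : ℕ) : ℝ))) := by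
            rw [one_div_mul_one_div]
        _ ≤ (1 / Real.sqrt ((i : ℝ) + 1)) * cA := by
            rw [← e1]; exact mul_le_mul h2 h1 (by positivity) (by positivity)
        _ = fA i := by simp only [hfA, if_pos hih]; ring
        _ ≤ fA i + fB i := by linarith
    · -- old position: `√(i+2) ≥ √((j₀+2)∕2)`
      rw [not_le] at hih
      have hi2 : ((j₀ : ℝ) + 2) / 2 ≤ (i : ℝ) + 2 := by
        have : (j₀ : ℝ) + 2 ≤ 2 * ((i : ℝ) + 2) := by
          have : j₀ < 2 * (i + 1) := by omega
          have : (j₀ : ℝ) < 2 * ((i : ℝ) + 1) := by exact_mod_cast this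
          linarith
        linarith
      have h1 : 1 / Real.sqrt ((i : ℝ) + 2) ≤ 1 / Real.sqrt (((j₀ : ℝ) + 2) / 2) :=
        one_div_le_one_div_of_le (Real.sqrt_pos.2 (by positivity)) (Real.sqrt_le_sqrt hi2)
      have hq : Real.sqrt (((j₀ : ℝ) + 2) / 2) = Real.sqrt ((j₀ : ℝ) + 2) / Real.sqrt 2 := by
        rw [eq_div_iff hs2.ne']; exact hsJ2
      have e1 : 1 / Real.sqrt (((j₀ : ℝ) + 2) / 2) = cB := by
        rw [hcB, hq, one_div_div]
      calc 1 / (Real.sqrt ((i : ℝ) + 2) * (((j₀ + 1 - i : ℕ) : ℝ) * Real.sqrt ((j₀ + 1 - i : ℕ) : ℝ)))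
          = (1 / Real.sqrt ((i : ℝ) + 2)) * (1 / (((j₀ + 1 - i : ℕ) : ℝ) * Real.sqrt ((j₀ + 1 - i : ℕ) : ℝ))) := by
            rw [one_div_mul_one_div]
        _ ≤ cB * (1 / (((j₀ + 1 - i : ℕ) : ℝ) * Real.sqrt ((j₀ + 1 - i : ℕ) : ℝ))) := by
            rw [← e1]; exact mul_le_mul_of_nonneg_right h1 (by positivity)
        _ = fB i := rfl
        _ ≤ fA i + fB i := by linarith
  -- the young half: the square-root head
  have hA : ∑ i ∈ range j₀, fA i ≤ cA * (2 * Real.sqrt ((j₀ : ℝ) + 2)) := by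
    have hsub : ∑ i ∈ range j₀, fA i ≤ ∑ i ∈ range (h + 1), cA * (1 / Real.sqrt ((i : ℝ) + 1)) := by
      calc ∑ i ∈ range j₀, fA i = ∑ i ∈ (range j₀).filter (fun i => i ≤ h), cA * (1 / Real.sqrt ((i : ℝ) + 1)) := by
            rw [Finset.sum_filter]
        _ ≤ ∑ i ∈ range (h + 1), cA * (1 / Real.sqrt ((i : ℝ) + 1)) := by
            refine Finset.sum_le_sum_of_subset_of_nonneg ?_ fun i _ _ => by positivity
            intro i hi
            have := (Finset.mem_filter.mp hi).2
            exact Finset.mem_range.mpr (by omega)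
    have hhead := sum_inv_sqrt_mul_succ_le one_pos (h + 1)
    simp only [one_mul, Real.sqrt_one, div_one] at hhead
    have hhj : ((h + 1 : ℕ) : ℝ) ≤ (j₀ : ℝ) + 2 := by exact_mod_cast (show h + 1 ≤ j₀ + 2 by omega)
    have hh2 : Real.sqrt (((h + 1 : ℕ) : ℝ)) ≤ Real.sqrt ((j₀ : ℝ) + 2) := Real.sqrt_le_sqrt hhj
    calc ∑ i ∈ range j₀, fA i ≤ ∑ i ∈ range (h + 1), cA * (1 / Real.sqrt ((i : ℝ) + 1)) := hsub
      _ = cA * ∑ i ∈ range (h + 1), 1 / Real.sqrt ((i : ℝ) + 1) := by rw [Finset.mul_sum]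
      _ ≤ cA * (2 * Real.sqrt (((h + 1 : ℕ) : ℝ))) := mul_le_mul_of_nonneg_left hhead hcA0
      _ ≤ cA * (2 * Real.sqrt ((j₀ : ℝ) + 2)) := mul_le_mul_of_nonneg_left (by linarith) hcA0
  -- the old half: the `3∕2`-tail, reflected
  have hB : ∑ i ∈ range j₀, fB i ≤ cB * 2 := by
    have hrefl : ∑ i ∈ range j₀, 1 / ((((j₀ + 1 - i : ℕ) : ℝ)) * Real.sqrt ((j₀ + 1 - i : ℕ) : ℝ))
        = ∑ t ∈ range j₀, 1 / ((((t + 1 : ℕ) : ℝ) + 1) * Real.sqrt (((t + 1 : ℕ) : ℝ) + 1)) := by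
      rw [← Finset.sum_range_reflect (fun t : ℕ => 1 / ((((t + 1 : ℕ) : ℝ) + 1) * Real.sqrt (((t + 1 : ℕ) : ℝ) + 1))) j₀]
      refine Finset.sum_congr rfl fun i hi => ?_
      have hi' := Finset.mem_range.mp hi
      have e : ((j₀ + 1 - i : ℕ) : ℝ) = ((j₀ - 1 - i + 1 : ℕ) : ℝ) + 1 := by
        rw [show j₀ + 1 - i = (j₀ - 1 - i + 1) + 1 by omega]; push_cast; ring
      rw [e]
    have htail := sum_Ico_inv_mul_sqrt_le (le_refl 1) j₀
    rw [Finset.sum_Ico_eq_sum_range, show 1 + j₀ - 1 = j₀ by omega] at htail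
    simp only [Nat.cast_one, Real.sqrt_one, div_one] at htail
    have htail' : ∑ t ∈ range j₀, 1 / ((((t + 1 : ℕ) : ℝ) + 1) * Real.sqrt (((t + 1 : ℕ) : ℝ) + 1)) ≤ 2 := by
      refine le_trans (le_of_eq (Finset.sum_congr rfl fun t _ => ?_)) htail
      rw [Nat.add_comm t 1]
    calc ∑ i ∈ range j₀, fB i = cB * ∑ i ∈ range j₀, 1 / ((((j₀ + 1 - i : ℕ) : ℝ)) * Real.sqrt ((j₀ + 1 - i : ℕ) : ℝ)) := by
          rw [Finset.mul_sum]
      _ ≤ cB * 2 := by rw [hrefl]; exact mul_le_mul_of_nonneg_left htail' hcB0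
  -- assemble
  have hsum2 : ∑ i ∈ range j₀, (fA i + fB i) ≤ cA * (2 * Real.sqrt ((j₀ : ℝ) + 2)) + cB * 2 := by
    rw [Finset.sum_add_distrib]; exact add_le_add hA hB
  refine ((Finset.sum_le_sum hterm).trans hsum2).trans ?_
  have e : cA * (2 * Real.sqrt ((j₀ : ℝ) + 2)) + cB * 2 = 4 * Real.sqrt 2 / ((j₀ : ℝ) + 2) + 2 * Real.sqrt 2 / Real.sqrt ((j₀ : ℝ) + 2) := by
    simp only [hcA, hcB]
    have es : Real.sqrt ((j₀ : ℝ) + 2) * Real.sqrt ((j₀ : ℝ) + 2) = (j₀ : ℝ) + 2 := Real.mul_self_sqrt hJ.le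
    field_simp
    ring
  rw [e]
  -- `4√2∕(j₀+2) ≤ 4√2∕√(j₀+2)` since `√(j₀+2) ≤ j₀+2`
  have hsq : Real.sqrt ((j₀ : ℝ) + 2) ≤ (j₀ : ℝ) + 2 := by
    have h1 : (1 : ℝ) ≤ (j₀ : ℝ) + 2 := by have : (0:ℝ) ≤ j₀ := Nat.cast_nonneg _; linarith
    calc Real.sqrt ((j₀ : ℝ) + 2) ≤ Real.sqrt (((j₀ : ℝ) + 2) ^ 2) := Real.sqrt_le_sqrt (by nlinarith)
      _ = (j₀ : ℝ) + 2 := Real.sqrt_sq (by linarith)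
  have h3 : 4 * Real.sqrt 2 / ((j₀ : ℝ) + 2) ≤ 4 * Real.sqrt 2 / Real.sqrt ((j₀ : ℝ) + 2) :=
    div_le_div_of_nonneg_left (by positivity) hsJ hsq
  calc 4 * Real.sqrt 2 / ((j₀ : ℝ) + 2) + 2 * Real.sqrt 2 / Real.sqrt ((j₀ : ℝ) + 2)
      ≤ 4 * Real.sqrt 2 / Real.sqrt ((j₀ : ℝ) + 2) + 2 * Real.sqrt 2 / Real.sqrt ((j₀ : ℝ) + 2) := by linarith
    _ = 6 * Real.sqrt 2 / Real.sqrt ((j₀ : ℝ) + 2) := by ring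

/-- SHAPE (T2) WITH `A₂ = 18√2·M` for the majorant `τ(k) = 3M∕√(k+1)`:
`Σ_{i<j₀} τ(i+1)τ(j₀−i)∕(j₀+1−i) ≤ 18√2M·τ(j₀+1)` (`sum_conv_sqrt_le` times `9M²`). [folklore] -/
theorem borderline_T2 (M : ℝ) (j₀ : ℕ) :
    ∑ i ∈ range j₀, (3 * M / Real.sqrt (((i + 1 : ℕ) : ℝ) + 1)) * (3 * M / Real.sqrt (((j₀ - i : ℕ) : ℝ) + 1))
        / ((j₀ + 1 - i : ℕ) : ℝ)
      ≤ 18 * Real.sqrt 2 * M * (3 * M / Real.sqrt (((j₀ + 1 : ℕ) : ℝ) + 1)) := by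
  have h := sum_conv_sqrt_le j₀
  have e : ∀ i ∈ range j₀, (3 * M / Real.sqrt (((i + 1 : ℕ) : ℝ) + 1)) * (3 * M / Real.sqrt (((j₀ - i : ℕ) : ℝ) + 1))
        / ((j₀ + 1 - i : ℕ) : ℝ)
      = 9 * M ^ 2 * (1 / (Real.sqrt ((i : ℝ) + 2) * (((j₀ + 1 - i : ℕ) : ℝ) * Real.sqrt ((j₀ + 1 - i : ℕ) : ℝ)))) := by
    intro i hi
    have hi' := Finset.mem_range.mp hi
    have e1 : ((i + 1 : ℕ) : ℝ) + 1 = (i : ℝ) + 2 := by push_cast; ring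
    have e2 : ((j₀ - i : ℕ) : ℝ) + 1 = ((j₀ + 1 - i : ℕ) : ℝ) := by
      rw [show j₀ + 1 - i = (j₀ - i) + 1 by omega]; push_cast; ring
    rw [e1, e2]
    have hv0 : (0 : ℝ) < ((j₀ + 1 - i : ℕ) : ℝ) := by exact_mod_cast (by omega : 0 < j₀ + 1 - i)
    have hsv : 0 < Real.sqrt ((j₀ + 1 - i : ℕ) : ℝ) := Real.sqrt_pos.2 hv0
    have hsi : 0 < Real.sqrt ((i : ℝ) + 2) := Real.sqrt_pos.2 (by positivity)
    field_simp
    ring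
  rw [Finset.sum_congr rfl e, ← Finset.mul_sum]
  have eJ : ((j₀ + 1 : ℕ) : ℝ) + 1 = (j₀ : ℝ) + 2 := by push_cast; ring
  rw [eJ]
  calc 9 * M ^ 2 * ∑ i ∈ range j₀, 1 / (Real.sqrt ((i : ℝ) + 2) * (((j₀ + 1 - i : ℕ) : ℝ) * Real.sqrt ((j₀ + 1 - i : ℕ) : ℝ)))
      ≤ 9 * M ^ 2 * (6 * Real.sqrt 2 / Real.sqrt ((j₀ : ℝ) + 2)) := mul_le_mul_of_nonneg_left h (by positivity)
    _ = 18 * Real.sqrt 2 * M * (3 * M / Real.sqrt ((j₀ : ℝ) + 2)) := by ring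

/-! ## §2 The two-sided rate for the borderline family -/

/-- **ROAD P3 — THE RATE IN THE CUTOFF AT THE BORDERLINE PROFILE, UPPER SIDE.**  A family `K ↦ g K` of runs of the order-0 profile family with
the borderline profile `ρ(a) = M∕((a+1)√(a+1))` (`M > 0`), in ]0,γ], pinned at one `g_IR` (`b > 0`, `Σ_{a<N} ρ_a ≤ W`, `Wγ < b`).  THEN for
every infrared distance `m` with `18√2·M ≤ b√b·√m` and every cutoff `n ≥ m − 1`:
`0 ≤ astar g m − invSq g m n ≤ Λ·√m·3M∕√(n+2)`, `Λ = 4∕√b + 24√2κ∕((1−Wγ∕b)√b)`, `κ = (b+Wγ)∕b` — the third file's `astar_sub_invSq_le_rate`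
with `τ(k) = 3M∕√(k+1)`, `A₁ = 3`, `A₂ = 18√2M`. [cite: Balaban1987RG1, (0.20) p.256, (0.31) and Thm 2 p.259] -/
theorem borderline_rate
    (hβ : ∀ (k : ℕ) (p : Fin (k + 1) → ℝ),
      β k p = b + ∑ i : Fin (k + 1), ρ (k - i) * min (p (Fin.last k)) (|p (Fin.last k) - p i|))
    (hb : 0 < b) (hγ : 0 < γ) (hM : 0 < M) (hρ : ∀ a, ρ a = M / (((a : ℝ) + 1) * Real.sqrt ((a : ℝ) + 1)))
    (hρW : ∀ n, ∑ a ∈ range n, ρ a ≤ W) (hsmall : W * γ < b)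
    {g : ℕ → ℕ → ℝ} {gIR : ℝ} (hrun : ∀ K, RGEqH K β (g K)) (hbox : ∀ K i, i ≤ K → 0 < g K i ∧ g K i ≤ γ)
    (hpin : ∀ K, g K K = gIR) {m n : ℕ} (hm : 18 * Real.sqrt 2 * M ≤ b * Real.sqrt b * Real.sqrt (m : ℝ)) (hmn : m ≤ n + 1) :
    0 ≤ astar g m - invSq g m n ∧ astar g m - invSq g m n
      ≤ (4 / Real.sqrt b + 8 * Real.sqrt 2 * ((b + W * γ) / b) * 3 / ((1 - W * γ / b) * Real.sqrt b))
        * Real.sqrt (m : ℝ) * (3 * M / Real.sqrt (((n + 1 : ℕ) : ℝ) + 1)) := by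
  have hρ0 : ∀ a, 0 ≤ ρ a := fun a => by rw [hρ a]; positivity
  have hτ0 : ∀ k : ℕ, 0 ≤ 3 * M / Real.sqrt ((k : ℝ) + 1) := fun k => by positivity
  have hτmono : ∀ k l : ℕ, k ≤ l → 3 * M / Real.sqrt ((l : ℝ) + 1) ≤ 3 * M / Real.sqrt ((k : ℝ) + 1) := by
    intro k l hkl
    exact div_le_div_of_nonneg_left (by positivity) (Real.sqrt_pos.2 (by positivity))
      (Real.sqrt_le_sqrt (by exact_mod_cast Nat.add_le_add_right hkl 1))
  exact astar_sub_invSq_le_rate (τ := fun k => 3 * M / Real.sqrt ((k : ℝ) + 1)) (A₁ := 3) (A₂ := 18 * Real.sqrt 2 * M)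
    hβ hb hγ hρ0 hρW hsmall hτ0 hτmono (fun k N hkN => borderline_tail_le hM.le hρ hkN) (by norm_num)
    (fun K N hK => borderline_T1 hM.le hρ K N hK) (fun j₀ => borderline_T2 M j₀) hrun hbox hpin hm hmn

/-- **ROAD P3 — THE RATE IN THE CUTOFF AT THE BORDERLINE PROFILE, LOWER SIDE (no smallness).**  Same family (`b > 0`, `M > 0`, `Σ_{a<N} ρ_a ≤
W`); THEN for every infrared distance `m ≥ 1` and cutoff `n ≥ m − 1` SOME `m′ ≤ m` has
`√m·M∕(3√(n+m+1)) ≤ 8κ₂√b₂·(1 + Wγ∕b)·(astar g m′ − invSq g m′ (n+m−m′))` (`b₂ = 1∕g_IR² + b + Wγ`, `κ₂ = b₂∕b`) — the fourth file's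
`astar_sub_invSq_rate_lower` with the minorant `τ′(k) = M∕(3√(k+1))`.  With `borderline_rate`: within infrared distance `m` of the pin, the
largest continuum discrepancy at cutoff `≈ n` is `≍ √m∕√n`. [cite: Balaban1987RG1, (0.20) p.256, (0.31) and Thm 2 p.259] -/
theorem borderline_rate_lower
    (hβ : ∀ (k : ℕ) (p : Fin (k + 1) → ℝ),
      β k p = b + ∑ i : Fin (k + 1), ρ (k - i) * min (p (Fin.last k)) (|p (Fin.last k) - p i|))
    (hb : 0 < b) (hγ : 0 < γ) (hM : 0 < M) (hρ : ∀ a, ρ a = M / (((a : ℝ) + 1) * Real.sqrt ((a : ℝ) + 1)))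
    (hρW : ∀ n, ∑ a ∈ range n, ρ a ≤ W)
    {g : ℕ → ℕ → ℝ} {gIR : ℝ} (hrun : ∀ K, RGEqH K β (g K)) (hbox : ∀ K i, i ≤ K → 0 < g K i ∧ g K i ≤ γ)
    (hpin : ∀ K, g K K = gIR) {m n : ℕ} (hm : 1 ≤ m) (hmn : m ≤ n + 1) :
    ∃ m', m' ≤ m ∧
      Real.sqrt (m : ℝ) * (M / (3 * Real.sqrt (((n + m : ℕ) : ℝ) + 1)))
        ≤ 8 * ((1 / gIR ^ 2 + (b + W * γ)) / b) * Real.sqrt (1 / gIR ^ 2 + (b + W * γ)) * (1 + W * γ / b)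
          * (astar g m' - invSq g m' (n + m - m')) := by
  have hρ0 : ∀ a, 0 ≤ ρ a := fun a => by rw [hρ a]; positivity
  have hτ'mono : ∀ k l : ℕ, k ≤ l → M / (3 * Real.sqrt ((l : ℝ) + 1)) ≤ M / (3 * Real.sqrt ((k : ℝ) + 1)) := by
    intro k l hkl
    exact div_le_div_of_nonneg_left hM.le (by positivity) (mul_le_mul_of_nonneg_left
      (Real.sqrt_le_sqrt (by exact_mod_cast Nat.add_le_add_right hkl 1)) (by norm_num))
  exact astar_sub_invSq_rate_lower (τ' := fun k => M / (3 * Real.sqrt ((k : ℝ) + 1))) hβ hb hγ hρ0 hρW hτ'mono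
    (fun k N hk hkN => borderline_tail_ge hM.le hρ hk hkN) hrun hbox hpin hm hmn

/-- **END — A BORDERLINE FAMILY WITH ITS TWO-SIDED RATE.**  For the borderline profile `ρ(a) = M∕((a+1)√(a+1))` (`M > 0`) and `b > 0`,
`γ > 0` with `6Mγ ≤ b`, `g_IR ∈ ]0,γ]`: there is a pinned family of runs of the order-0 profile family whose continuum coupling is reached
from every cutoff `n ≥ m − 1` within `Λ·√m·3M∕√(n+2)` at each infrared distance `m` with `18√2M ≤ b√b√m`, and which, for every `1 ≤ m ≤ n+1`,
has SOME `m′ ≤ m` with `√m·M∕(3√(n+m+1)) ≤ 8κ₂√b₂(1+Wγ∕b)·(astar g m′ − invSq g m′ (n+m−m′))`, `W = 3M` (generation 47's `runFamily_exists`;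
generation 48 showed the same family m-UNIFORM with INFINITE half moment). [cite: Balaban1987RG1, (0.20) p.256, (0.31) and Thm 2 p.259] -/
theorem exists_family_borderline_rate {M b γ gIR : ℝ} (hM : 0 < M)
    (hρ : ∀ a, ρ a = M / (((a : ℝ) + 1) * Real.sqrt ((a : ℝ) + 1)))
    (hb : 0 < b) (hγ : 0 < γ) (hsmall : 6 * M * γ ≤ b) (hgIR : 0 < gIR) (hgIRγ : gIR ≤ γ) :
    ∃ (β : HBeta) (g : ℕ → ℕ → ℝ),
      (∀ (k : ℕ) (p : Fin (k + 1) → ℝ),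
          β k p = b + ∑ i : Fin (k + 1), ρ (k - i) * min (p (Fin.last k)) (|p (Fin.last k) - p i|))
      ∧ (∀ K, RGEqH K β (g K)) ∧ (∀ K i, i ≤ K → 0 < g K i ∧ g K i ≤ γ) ∧ (∀ K, g K K = gIR)
      ∧ (∀ m n : ℕ, 18 * Real.sqrt 2 * M ≤ b * Real.sqrt b * Real.sqrt (m : ℝ) → m ≤ n + 1 →
          astar g m - invSq g m n
            ≤ (4 / Real.sqrt b + 8 * Real.sqrt 2 * ((b + 3 * M * γ) / b) * 3 / ((1 - 3 * M * γ / b) * Real.sqrt b))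
              * Real.sqrt (m : ℝ) * (3 * M / Real.sqrt (((n + 1 : ℕ) : ℝ) + 1)))
      ∧ (∀ m n : ℕ, 1 ≤ m → m ≤ n + 1 → ∃ m', m' ≤ m ∧
          Real.sqrt (m : ℝ) * (M / (3 * Real.sqrt (((n + m : ℕ) : ℝ) + 1)))
            ≤ 8 * ((1 / gIR ^ 2 + (b + 3 * M * γ)) / b) * Real.sqrt (1 / gIR ^ 2 + (b + 3 * M * γ)) * (1 + 3 * M * γ / b)
              * (astar g m' - invSq g m' (n + m - m'))) := by
  let β : HBeta := fun k p => b + ∑ i : Fin (k + 1), ρ (k - i) * min (p (Fin.last k)) (|p (Fin.last k) - p i|)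
  have hβ : ∀ (k : ℕ) (p : Fin (k + 1) → ℝ),
      β k p = b + ∑ i : Fin (k + 1), ρ (k - i) * min (p (Fin.last k)) (|p (Fin.last k) - p i|) := fun k p => rfl
  have hρ0 : ∀ a, 0 ≤ ρ a := fun a => by rw [hρ a]; positivity
  have hρW := borderline_sum_le hM.le hρ
  have hsmall' : (3 * M) * γ < b := by nlinarith [mul_pos hM hγ]
  obtain ⟨g, hrun, hbox, hpin⟩ :=
    RemainderExplicitHistoryDiagonalProfile.runFamily_exists (W := 3 * M) hβ hb hγ hρ0 hρW (by nlinarith [mul_pos hM hγ]) hgIR hgIRγ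
  refine ⟨β, g, hβ, hrun, hbox, hpin, fun m n hm hmn => ?_, fun m n hm hmn => ?_⟩
  · exact (borderline_rate hβ hb hγ hM hρ hρW hsmall' hrun hbox hpin hm hmn).2
  · exact borderline_rate_lower hβ hb hγ hM hρ hρW hrun hbox hpin hm hmn

end Summit.QuantumFields.BalabanUV.Beta.RemainderExplicitHistoryDiagonalRateBorderline

end
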